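/-
Copyright: derived here (Resolution Observatory cell `pub-rosobs`, carver gen 50). AI-written Lean; AI review is
weaker than expert review.  Companion file of the cell's POLYNOMIAL weighted-centre model `W(f)`: the identity core
of engine 1's LC-A (A) "pure cofactor extraction" (THEOREM-LC-eng1-g33 §2 STEP 2 (A); CARVER-NOTES-eng1-g33 T8).
Instrument — NOT a resolution theorem and NOT a statement about the invariant of [AbramovichTemkinWlodarczyk2024].
-/
import Mathlib.RingTheory.MvPolynomial.Basic
import Mathlib.Algebra.MvPolynomial.CommRing
import Mathlib.Algebra.CharP.Lemmas
import Mathlib.Algebra.Polynomial.Div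
import Mathlib.Data.Finsupp.Weight
import HarnessLib

/-!
# Pure cofactor extraction (LC-A (A)): the coefficient of `σ^{pj}·ε_y` in `(ε_{a₀} + m)^p · R(ε + A)` is `c^p · r_y`

Setting: `k` a commutative ring of prime characteristic `p`; the ring `k[σ][ε_ι] = MvPolynomial ι k[X]` (`X = σ`);
a slot `a₀ : ι`; a LINEAR form `R = Σ_{y ∈ S} r_y ε_y` with `r_y ∈ k`; the shift of the slot `a₀`,
`m = c·σ^j + q + m₁` with `c ∈ k`, `q ∈ σ^{j+1}·k[σ]` (so `c·σ^j` is the only pure term of `σ`-degree `≤ j`) and `m₁`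
with zero constant coefficient (every monomial of `m₁` contains an `ε`); shifts `A_y ∈ σ·k[σ][ε_ι]` of the cofactor
variables (every `σ`-coefficient of `A_y` has zero constant term).

* `coeff_pureCofactor` (**LC-A (A)**, THEOREM-LC-eng1-g33 §2 STEP 2 (A); T8): for `y ∈ S`, the coefficient of the
  monomial `σ^{pj}·ε_y` in `(ε_{a₀} + m)^p · Σ_{y'} r_{y'} (ε_{y'} + A_{y'})` is `c^p · r_y`; `coeff_pureCofactor_sub`
  is the verbatim form with `− ε_{a₀}^p · R` subtracted (that term contributes nothing).
  Proof: `(ε_{a₀} + m)^p = ε_{a₀}^p + c^p σ^{pj} + q^p + m₁^p` (Frobenius); `ε_{a₀}^p·(…)` has `ε`-degree `≥ p ≥ 2`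
  (`coeff_single_X_pow_mul`), `m₁^p·(…)` likewise (`coeff_single_mul_of_constantCoeff`), `q^p ∈ σ^{p(j+1)}` exceeds
  the `σ`-degree `pj` (`Polynomial` divisibility), and `c^p σ^{pj}·Σ r_{y'}(ε_{y'} + A_{y'})` contributes
  `c^p·(r_y + Σ r_{y'}·[σ⁰ε_y] A_{y'}) = c^p r_y` because `A ≡ 0 (mod σ)`.
* the two vanishing lemmas are stated for any commutative semiring and are reusable.

What is NOT here: part (B) of LC-A (the `G₀`-summand contributes `0` to the same coefficient), which needs the window
inequalities (W1)–(W5) of THEOREM-LC §1 as hypotheses on the shifts; gradings.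

[ATW24] Abramovich–Temkin–Włodarczyk, Algebra & Number Theory 18 (2024), Thm. 5.3.1 (2)–(3) (p. 1578).  CONTEXT ONLY
(graded automorphisms of the graded algebra of the centre); the identity is elementary and ours.
-/

namespace Literature.AlgebraicGeometry.Resolution.WeightedBlowup

open MvPolynomial
open scoped Polynomial

section Vanishing

variable {R : Type*} [CommSemiring R] {ι : Type*} [DecidableEq ι]

/-- In `ε_i^n · F` with `n ≥ 2` the coefficient of every degree-one monomial `ε_y` is `0` (elementary; ours).
[cite: AbramovichTemkinWlodarczyk2024, Thm. 5.3.1 (2)–(3) (p. 1578)] -/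
theorem coeff_single_X_pow_mul (i y : ι) {n : ℕ} (hn : 2 ≤ n) (F : MvPolynomial ι R) :
    coeff (Finsupp.single y 1) (X i ^ n * F) = 0 := by
  obtain ⟨n, rfl⟩ := Nat.exists_eq_add_of_le hn
  have : (X i : MvPolynomial ι R) ^ (2 + n) * F = X i * (X i * (X i ^ n * F)) := by ring
  rw [this, coeff_X_mul']
  split_ifs with h
  · have hi : i = y := (Finsupp.single_apply_ne_zero.mp (Finsupp.mem_support_iff.mp h)).1
    subst hi
    rw [tsub_self, coeff_X_mul']
    simp
  · rfl

/-- If `u` and `G` both have zero constant coefficient, the coefficient of every degree-one monomial `ε_y` in `u · G`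
is `0` (elementary; ours: a monomial of `u·G` is a product of a monomial of `u` and one of `G`, both of positive
degree). [cite: AbramovichTemkinWlodarczyk2024, Thm. 5.3.1 (2)–(3) (p. 1578)] -/
theorem coeff_single_mul_of_constantCoeff (y : ι) {u G : MvPolynomial ι R} (hu : constantCoeff u = 0)
    (hG : constantCoeff G = 0) : coeff (Finsupp.single y 1) (u * G) = 0 := by
  rw [coeff_mul]
  refine Finset.sum_eq_zero fun x hx => ?_
  have hsum : x.1 + x.2 = Finsupp.single y 1 := Finset.mem_antidiagonal.mp hx
  have hdeg : Finsupp.degree x.1 + Finsupp.degree x.2 = 1 := by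
    rw [← map_add, hsum, Finsupp.degree_single]
  rcases Nat.eq_zero_or_pos (Finsupp.degree x.1) with h1 | h1
  · rw [(Finsupp.degree_eq_zero_iff _).mp h1, ← constantCoeff_eq, hu, zero_mul]
  · have h2 : Finsupp.degree x.2 = 0 := by omega
    rw [(Finsupp.degree_eq_zero_iff _).mp h2, ← constantCoeff_eq, hG, mul_zero]

end Vanishing

section PureCofactor

variable {k : Type*} [CommRing k] (p : ℕ) [hp : Fact p.Prime] [CharP k p] {ι : Type*} [DecidableEq ι]

/-- The `σ`-constant part of the `ε_y`-coefficient of the shifted linear form `Σ_{y'} r_{y'} (ε_{y'} + A_{y'})` is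
`r_y` when every `A_{y'} ≡ 0 (mod σ)` (elementary; ours). [cite: AbramovichTemkinWlodarczyk2024, Thm. 5.3.1 (2)–(3) (p. 1578)] -/
theorem coeff_zero_coeff_single_linearShift (S : Finset ι) (r : ι → k) (A : ι → MvPolynomial ι k[X])
    (hA : ∀ y' d, ((A y').coeff d).coeff 0 = 0) {y : ι} (hy : y ∈ S) :
    (coeff (Finsupp.single y 1) (∑ y' ∈ S, C (Polynomial.C (r y')) * (X y' + A y'))).coeff 0 = r y := by
  rw [coeff_sum, Polynomial.finsetSum_coeff]
  have : ∀ y' ∈ S, ((coeff (Finsupp.single y 1)) (C (Polynomial.C (r y')) * (X y' + A y'))).coeff 0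
      = if y' = y then r y else 0 := by
    intro y' _
    rw [coeff_C_mul, coeff_add, coeff_X, Polynomial.coeff_C_mul, Polynomial.coeff_add, hA, add_zero]
    by_cases h : y' = y
    · subst h
      rw [if_pos rfl, if_pos rfl, Polynomial.coeff_one_zero, mul_one]
    · rw [if_neg (fun h' => h ((Finsupp.single_left_inj one_ne_zero).mp h')), if_neg h,
        Polynomial.coeff_zero, mul_zero]
  rw [Finset.sum_congr rfl this, Finset.sum_ite_eq' S y, if_pos hy]

/-- **LC-A (A), pure cofactor extraction** (THEOREM-LC-eng1-g33 §2 STEP 2 (A); CARVER-NOTES T8; ours).  In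
`k[σ][ε_ι]`, `char k = p`: let `R(ε + A) = Σ_{y' ∈ S} r_{y'} (ε_{y'} + A_{y'})` with `r ∈ k`, `A_{y'} ≡ 0 (mod σ)`;
let the shift of `ε_{a₀}` be `m = c σ^j + q + m₁` with `σ^{j+1} ∣ q` and `m₁` without constant coefficient.  Then
for `y ∈ S` the coefficient of `σ^{pj}·ε_y` in `(ε_{a₀} + m)^p · R(ε + A)` equals `c^p · r_y`.
[cite: AbramovichTemkinWlodarczyk2024, Thm. 5.3.1 (2)–(3) (p. 1578)] -/
theorem coeff_pureCofactor (a₀ : ι) (S : Finset ι) (r : ι → k) (c : k) (j : ℕ) (q : k[X])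
    (hq : Polynomial.X ^ (j + 1) ∣ q) (m₁ : MvPolynomial ι k[X]) (hm₁ : constantCoeff m₁ = 0)
    (A : ι → MvPolynomial ι k[X]) (hA : ∀ y' d, ((A y').coeff d).coeff 0 = 0) {y : ι} (hy : y ∈ S) :
    (coeff (Finsupp.single y 1)
        ((X a₀ + (C (Polynomial.C c * Polynomial.X ^ j + q) + m₁)) ^ p
          * ∑ y' ∈ S, C (Polynomial.C (r y')) * (X y' + A y'))).coeff (p * j) = c ^ p * r y := by
  have hp2 : 2 ≤ p := hp.out.two_le
  set Rsh : MvPolynomial ι k[X] := ∑ y' ∈ S, C (Polynomial.C (r y')) * (X y' + A y') with hRsh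
  -- Frobenius: (ε_{a₀} + m)^p = ε_{a₀}^p + C((cσ^j + q)^p) + m₁^p and (cσ^j + q)^p = c^p σ^{jp} + q^p
  have hfrob : (X a₀ + (C (Polynomial.C c * Polynomial.X ^ j + q) + m₁)) ^ p
      = X a₀ ^ p + (C (Polynomial.C (c ^ p) * Polynomial.X ^ (j * p)) + C (q ^ p) + m₁ ^ p) := by
    rw [add_pow_char, add_pow_char, ← map_pow, add_pow_char, mul_pow, ← Polynomial.C_pow, ← pow_mul, map_add]
  rw [hfrob, add_mul, add_mul, add_mul, coeff_add, coeff_add, coeff_add, Polynomial.coeff_add,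
    Polynomial.coeff_add, Polynomial.coeff_add]
  -- (1) ε_{a₀}^p · Rsh : no degree-one monomial
  rw [coeff_single_X_pow_mul a₀ y hp2, Polynomial.coeff_zero, zero_add]
  -- (2) c^p σ^{jp} · Rsh : contributes c^p · r_y
  rw [coeff_C_mul, mul_comm j p, mul_assoc, Polynomial.coeff_C_mul, Polynomial.coeff_X_pow_mul', if_pos le_rfl,
    Nat.sub_self, coeff_zero_coeff_single_linearShift S r A hA hy]
  -- (3) q^p · Rsh : σ-order ≥ p(j+1) > pj
  have h3 : (coeff (Finsupp.single y 1) (C (q ^ p) * Rsh)).coeff (p * j) = 0 := by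
    rw [coeff_C_mul]
    have hdvd : Polynomial.X ^ ((j + 1) * p) ∣ q ^ p * coeff (Finsupp.single y 1) Rsh :=
      Dvd.dvd.mul_right (by simpa only [← pow_mul] using pow_dvd_pow_of_dvd hq p) _
    exact Polynomial.X_pow_dvd_iff.mp hdvd (p * j) (by rw [add_mul, one_mul, mul_comm j p]; omega)
  -- (4) m₁^p · Rsh : no degree-one monomial (m₁ and m₁^{p-1}·Rsh have zero constant coefficient)
  have h4 : (coeff (Finsupp.single y 1) (m₁ ^ p * Rsh)).coeff (p * j) = 0 := by
    obtain ⟨n, hn⟩ := Nat.exists_eq_add_of_le hp2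
    have : m₁ ^ p * Rsh = m₁ * (m₁ * (m₁ ^ n * Rsh)) := by rw [hn]; ring
    rw [this, coeff_single_mul_of_constantCoeff y hm₁ (by rw [map_mul, hm₁, zero_mul]),
      Polynomial.coeff_zero]
  rw [h3, h4, add_zero, add_zero]

/-- **LC-A (A)**, verbatim form of CARVER-NOTES-eng1-g33 T8 (ours): the same coefficient of
`(ε_{a₀} + m)^p · R(ε + A) − ε_{a₀}^p · R(ε)` is `c^p · r_y` — the subtracted term has no degree-one monomial.
[cite: AbramovichTemkinWlodarczyk2024, Thm. 5.3.1 (2)–(3) (p. 1578)] -/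
theorem coeff_pureCofactor_sub (a₀ : ι) (S : Finset ι) (r : ι → k) (c : k) (j : ℕ) (q : k[X])
    (hq : Polynomial.X ^ (j + 1) ∣ q) (m₁ : MvPolynomial ι k[X]) (hm₁ : constantCoeff m₁ = 0)
    (A : ι → MvPolynomial ι k[X]) (hA : ∀ y' d, ((A y').coeff d).coeff 0 = 0) {y : ι} (hy : y ∈ S) :
    (coeff (Finsupp.single y 1)
        ((X a₀ + (C (Polynomial.C c * Polynomial.X ^ j + q) + m₁)) ^ p
            * (∑ y' ∈ S, C (Polynomial.C (r y')) * (X y' + A y'))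
          - X a₀ ^ p * ∑ y' ∈ S, C (Polynomial.C (r y')) * X y')).coeff (p * j) = c ^ p * r y := by
  rw [coeff_sub, Polynomial.coeff_sub, coeff_pureCofactor p a₀ S r c j q hq m₁ hm₁ A hA hy,
    coeff_single_X_pow_mul a₀ y hp.out.two_le, Polynomial.coeff_zero, sub_zero]

end PureCofactor

end Literature.AlgebraicGeometry.Resolution.WeightedBlowup
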